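import Summits.BirchSwinnertonDyer.Rank1Residual.X9.PrintCertTamagawa
import Summits.BirchSwinnertonDyer.Rank1Residual.X9.PrintCertImage
import Summits.BirchSwinnertonDyer.BirchSwinnertonDyer.Theorems.PrintX9HeegnerLeaf
import Summits.BirchSwinnertonDyer.BirchSwinnertonDyer.Theorems.Rank1ResidualX9MuTransfer
import HarnessLib

/-!
# Leaves X9 / X10b — per-pair certificate records: the J-FREE door of route `PrintX9` (records v2)
# (companion of `X9/PrintCertTamagawa.lean`; door of seat p4: `Theorems/PrintX9HeegnerLeaf.lean`)

HONEST FRAMING (cell `bsd-print-x9`, D-0131 (2) print tier; partition leaf `ClassX9`): theorems only; no named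
fact; nothing booked; no leaf closed (`BSDpOnClassX9` stays `@[conjecture]`). The currency of every conclusion
is the door's: CONDITIONAL on rung K6's two class-wide items `KatoMuTransfer` (route decl `MuTransfer`, item
19629 — kernel-checked modulo Kato's package F1, LITERAL per referee RUL-2) and `AnalyticMuZeroOnClassX9`
(route decl `AnalyticMuZeroX9`, item 19630), through the landed kernel bridge
`integralMainConjectureOnClassX9_of_katoMuTransfer` and BCS 2025 Thm. 1.1.2 (a); PUBLISHED binders verbatim
those of `X9.bsdp_of_x9IntegralMainConjecture_of_heegnerRoad` (p4).

WHAT THIS FILE ADDS. Route `PrintX9` (rev 3) closes the leaf from crux J (item 20392, Heegner divisibility to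
Tamagawa depth), 19629 and 19630. p4's kernel `X9.bsdp_of_x9IntegralMainConjecture_of_heegnerRoad` needs J only
through its binder `htam0 : W.analyticRank = 1 → ¬ p ∣ ∏_ℓ c_ℓ(W)` — i.e. NOT AT ALL at rank-`0` pairs and at
rank-`1` pairs with `p ∤ ∏ c_ℓ`. With the records' KERNEL Tamagawa certificates (`Record.tamCheck`,
`X9/PrintCertTamagawa.lean`) that binder is DECIDED per pair on the data and DISCHARGED in the kernel, so:
* `Record.pPartBSD_of_check_of_tamCheck` — for a certified record with `r.rank = 1 → ¬ r.p ∣ r.tamagawa`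
  (decidable), ANY globally minimal elliptic `W` with the record's integral model satisfies the leaf's print
  shape `PPartBSD W p`, GIVEN 19629 ∧ 19630 (+ print), the record's two CLAIMS (`¬Surj`, `r_an = r.rank`)
  and NO J; `…_of_jLines` reads `¬Surj` from the image certificate modulo Zywina's five `j`-line facts, leaving
  the analytic rank as the ONLY claim;
* `Record.pPartBSD_of_check_of_tamCheck_of_imc` — the same from the typed engine `IntegralMainConjectureOnClassX9`.
Census (kernel counts in `X9/PrintCertTamagawaCertified*.lean`): of the 790 X9 records, 375 have rank `0`
and 319 have rank `1` with `p ∤ ∏ c_ℓ` — 694 pairs where J is not load-bearing; J carries exactly the 96 rank-`1`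
pairs with `p ∣ ∏ c_ℓ` (92 single-carrier = Jetchev's regime, 4 multi-prime: `6897c1`, `25773p1`, `25773q1`,
`126687c1`, all at `p = 5`).

References: [BurungaleCastellaSkinner2025] Thm. 1.1.2 (a), Cor. 1.3.1; [Kato2004Asterisque] Thm. 12.5, 17.4;
[GreenbergLNM1716] Conj. 1.11, Thm. 4.1; [MatarNekovar2019] Thm. 0.3, Prop. 5.26 (2); [JetchevSkinnerWan2017]
Thm. 3.3.1; [Silverman1994] IV.9.4 (Tate's algorithm); [Zywina2015] Thm. 1.4 (ii), 1.5 (ii); [Miller2011LMS] Def. 1.1.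
-/

set_option autoImplicit false

noncomputable section

open scoped Classical

open WeierstrassCurve Literature.NumberTheory.EllipticCurves Literature.NumberTheory.EllipticCurves.Rank1Residual
  Literature.NumberTheory.EllipticCurves.ModularForms
  Literature.NumberTheory.EllipticCurves.BurungaleCastellaSkinner2025
  Literature.NumberTheory.EllipticCurves.JetchevSkinnerWan2017
  Summit.BirchSwinnertonDyer.BirchSwinnertonDyer.Theorems.Rank1ResidualX1Defs
  Summit.BirchSwinnertonDyer.BirchSwinnertonDyer.Rank1Residual

namespace Summit.BirchSwinnertonDyer.Rank1Residual.X9.PrintCert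

namespace Record

variable (r : Record)

section Door

variable {W : WeierstrassCurve ℚ} [W.IsElliptic] [W.IsGloballyMinimal] (hI : integralModelInt W = r.intCurve)
include hI

/-- **The J-free door from the typed engine.** For a record passing the schema recheck (`hc`) and the KERNEL
Tamagawa check (`htc`), with `r.rank = 1 → ¬ r.p ∣ r.tamagawa` (decidable on the data: rank `0`, or rank `1`
off the Tamagawa line), any globally minimal elliptic `W / ℚ` with the record's integral model satisfies the
leaf's print shape `PPartBSD W p` — from the PUBLISHED binders of p4's
`X9.bsdp_of_x9IntegralMainConjecture_of_heegnerRoad` (verbatim), the typed rank-`0` engine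
`IntegralMainConjectureOnClassX9` (OPEN), and the record's two CLAIMS `¬Surj W p`, `r_an(W) = r.rank`. Crux J
(Heegner divisibility) is NOT used: its only trace in p4's kernel, `htam0`, is discharged by the certificate.
[cite: BurungaleCastellaSkinner2025, Cor. 1.3.1 and its proof (p. 4)] [cite: Silverman1994, IV.9.4]
[cite: Miller2011LMS, Def. 1.1] -/
theorem pPartBSD_of_check_of_tamCheck_of_imc
    (hGZ : ∀ (N : ℕ) [NeZero N] (W : WeierstrassCurve ℚ) (K : Type) [Field K] [NumberField K],
      gross_zagier N W K)
    (hKo : ∀ (N : ℕ) [NeZero N] (W : WeierstrassCurve ℚ) (K : Type) [Field K] [NumberField K],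
      kolyvagin N W K)
    (hMN : ∀ (N : ℕ) [NeZero N] (W : WeierstrassCurve ℚ) (K : Type) [Field K] [NumberField K],
      MatarNekovar2019.thm03_padicValNat_card_sha_le_of_irreducible N W K)
    (h526 : MatarNekovar2019.prop526_hasIrreducibleModPGaloisRep_baseChange)
    (h124a : thm124a_prop422_thm513_generator_constantCoeff)
    (h331 : thm331_anticyclotomicControl)
    (hGr : greenberg_charValue_rankZero) (hGZK : rank_eq_analyticRank_of_analyticRank_le_one)
    (hmodL : hasEntireLFunction_rat) (hmodP : nonempty_modularParametrizationData)
    (hnf : exists_isNewformOf) (hHL : HoffsteinLuo1997_exists_twist_L_one_ne_zero)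
    (hMaz : mazur_not_dvd_maninConstant_of_odd) (hNS : integral_neronScaling_of_isGloballyMinimal)
    (h5 : realPeriodRat_eq_unit_mul_plusPeriod)
    (hIMC : IntegralMainConjectureOnClassX9)
    (hc : r.check = true) {c : TamCert} (htc : r.tamCheck c = true) (hvac : r.rank = 1 → ¬ r.p ∣ r.tamagawa)
    {q : ℕ} [Fact q.Prime] (hq : q = r.p) (hp5 : 5 ≤ q)
    (hns : ¬ Surj W q) (hrank : W.analyticRank = r.rank) : PPartBSD W q := by
  have hX9c := r.classX9_of_check hI hc hq hp5 hns hrank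
  have hX9 := classX9_of_classX9_census W q hX9c
  have hran : W.analyticRank ≤ 1 := by rw [hrank]; exact (r.rank_le_one_shaAn_pos_of_check hc).1
  have htam0 : W.analyticRank = 1 → ¬ q ∣ W.tamagawaProduct := fun h1 =>
    r.not_dvd_tamagawaProduct_of_tamCheck hI htc (hvac (by rw [← hrank]; exact h1)) hq
  have hbsdp : BSDp W q :=
    X9.bsdp_of_x9IntegralMainConjecture_of_heegnerRoad hGZ hKo hMN h526 h124a h331 hGr hGZK hmodL hmodP hnf
      hHL hMaz hNS h5 W q hX9 hran htam0 hIMC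
  exact (pPartBSD_iff_pPart W q).mpr (pPart_of_bsdp hmodL hGZK W q hran hbsdp)

/-- **The J-free door from rung K6's two items** `KatoMuTransfer` (19629) and `AnalyticMuZeroOnClassX9` (19630),
through `integralMainConjectureOnClassX9_of_katoMuTransfer` and BCS 2025 Thm. 1.1.2 (a) (`hBCS`): the leaf's
print shape at every certified record with `r.rank = 1 → ¬ r.p ∣ r.tamagawa`, modulo the record's two claims.
[cite: BurungaleCastellaSkinner2025, Thm. 1.1.2 (a), Cor. 1.3.1] [cite: Kato2004Asterisque, Thm. 12.5, 17.4]
[cite: GreenbergLNM1716, Conj. 1.11, Thm. 4.1] [cite: Silverman1994, IV.9.4] -/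
theorem pPartBSD_of_check_of_tamCheck
    (hGZ : ∀ (N : ℕ) [NeZero N] (W : WeierstrassCurve ℚ) (K : Type) [Field K] [NumberField K],
      gross_zagier N W K)
    (hKo : ∀ (N : ℕ) [NeZero N] (W : WeierstrassCurve ℚ) (K : Type) [Field K] [NumberField K],
      kolyvagin N W K)
    (hMN : ∀ (N : ℕ) [NeZero N] (W : WeierstrassCurve ℚ) (K : Type) [Field K] [NumberField K],
      MatarNekovar2019.thm03_padicValNat_card_sha_le_of_irreducible N W K)
    (h526 : MatarNekovar2019.prop526_hasIrreducibleModPGaloisRep_baseChange)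
    (h124a : thm124a_prop422_thm513_generator_constantCoeff)
    (h331 : thm331_anticyclotomicControl)
    (hBCS : burungale_castella_skinner_charIdeal_eq_padicLFunction)
    (hGr : greenberg_charValue_rankZero) (hGZK : rank_eq_analyticRank_of_analyticRank_le_one)
    (hmodL : hasEntireLFunction_rat) (hmodP : nonempty_modularParametrizationData)
    (hnf : exists_isNewformOf) (hHL : HoffsteinLuo1997_exists_twist_L_one_ne_zero)
    (hMaz : mazur_not_dvd_maninConstant_of_odd) (hNS : integral_neronScaling_of_isGloballyMinimal)
    (h5 : realPeriodRat_eq_unit_mul_plusPeriod)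
    (h1 : KatoMuTransfer) (h2 : AnalyticMuZeroOnClassX9)
    (hc : r.check = true) {c : TamCert} (htc : r.tamCheck c = true) (hvac : r.rank = 1 → ¬ r.p ∣ r.tamagawa)
    {q : ℕ} [Fact q.Prime] (hq : q = r.p) (hp5 : 5 ≤ q)
    (hns : ¬ Surj W q) (hrank : W.analyticRank = r.rank) : PPartBSD W q :=
  r.pPartBSD_of_check_of_tamCheck_of_imc hI hGZ hKo hMN h526 h124a h331 hGr hGZK hmodL hmodP hnf hHL hMaz hNS h5
    (integralMainConjectureOnClassX9_of_katoMuTransfer hBCS h1 h2) hc htc hvac hq hp5 hns hrank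

/-- **The J-free door with `¬Surj` read from the image certificate** (Zywina's five `j`-line theorems as named
facts, `Record.not_surj_of_check`): the ONLY remaining claim is the analytic rank `hrank`.
[cite: Zywina2015, Thm. 1.4 (ii) and Thm. 1.5 (ii)] [cite: BurungaleCastellaSkinner2025, Thm. 1.1.2 (a), Cor. 1.3.1]
[cite: Silverman1994, IV.9.4] -/
theorem pPartBSD_of_check_of_tamCheck_of_jLines
    (hGZ : ∀ (N : ℕ) [NeZero N] (W : WeierstrassCurve ℚ) (K : Type) [Field K] [NumberField K],
      gross_zagier N W K)
    (hKo : ∀ (N : ℕ) [NeZero N] (W : WeierstrassCurve ℚ) (K : Type) [Field K] [NumberField K],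
      kolyvagin N W K)
    (hMN : ∀ (N : ℕ) [NeZero N] (W : WeierstrassCurve ℚ) (K : Type) [Field K] [NumberField K],
      MatarNekovar2019.thm03_padicValNat_card_sha_le_of_irreducible N W K)
    (h526 : MatarNekovar2019.prop526_hasIrreducibleModPGaloisRep_baseChange)
    (h124a : thm124a_prop422_thm513_generator_constantCoeff)
    (h331 : thm331_anticyclotomicControl)
    (hBCS : burungale_castella_skinner_charIdeal_eq_padicLFunction)
    (hGr : greenberg_charValue_rankZero) (hGZK : rank_eq_analyticRank_of_analyticRank_le_one)
    (hmodL : hasEntireLFunction_rat) (hmodP : nonempty_modularParametrizationData)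
    (hnf : exists_isNewformOf) (hHL : HoffsteinLuo1997_exists_twist_L_one_ne_zero)
    (hMaz : mazur_not_dvd_maninConstant_of_odd) (hNS : integral_neronScaling_of_isGloballyMinimal)
    (h5 : realPeriodRat_eq_unit_mul_plusPeriod)
    (h3s : zywina2015_thm12_not_surjective_three_of_j_eq_J2)
    (h3n : zywina2015_thm12_not_surjective_three_of_j_eq_J4)
    (h5s : zywina2015_thm14_not_surjective_five_of_j_eq_J4)
    (h5e : zywina2015_thm14_not_surjective_five_of_j_eq_J9)
    (h7 : zywina2015_thm15_not_surjective_seven_of_j_eq_J2)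
    (h1 : KatoMuTransfer) (h2 : AnalyticMuZeroOnClassX9)
    (hc : r.check = true) (hsome : r.imageCert.isSome = true) {c : TamCert} (htc : r.tamCheck c = true)
    (hvac : r.rank = 1 → ¬ r.p ∣ r.tamagawa) {q : ℕ} [Fact q.Prime] (hq : q = r.p) (hp5 : 5 ≤ q)
    (hrank : W.analyticRank = r.rank) : PPartBSD W q :=
  r.pPartBSD_of_check_of_tamCheck hI hGZ hKo hMN h526 h124a h331 hBCS hGr hGZK hmodL hmodP hnf hHL hMaz hNS h5 h1 h2
    hc htc hvac hq hp5 (r.not_surj_of_check hI hc hsome h3s h3n h5s h5e h7 hq) hrank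

end Door

end Record

end Summit.BirchSwinnertonDyer.Rank1Residual.X9.PrintCert

end
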